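import Summits.BirchSwinnertonDyer.BirchSwinnertonDyer.Theorems.ErratumRoadFiveIMCDivMemberDivisible
import Summits.BirchSwinnertonDyer.BirchSwinnertonDyer.Theorems.ErratumRoadFiveIMCDivMemberCongruenceB2
import Summits.BirchSwinnertonDyer.BirchSwinnertonDyer.Theorems.ErratumRoadFiveBigRepRationalTorsion
import HarnessLib

/-!
# K2 crux 20169 `IMCDivAtErratumDataAllR` (H3♭, re-oriented), ROAD FF v4 — stub 2, binder `e m`:
# the Lemma-2.1 divisibility hypotheses for the MEMBER `A_{g_m}|_{Γ_K}` through the congruence (b),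
# and both sides with the erratum's arithmetic inputs DISCHARGED

Cell `bsd-stepL`, seat `bsd-stepL-imc-p1` (g9). `--supports stmt-BirchSwinnertonDyer-20169 --as helper`.
HONEST FRAMING: bookkeeping on tree objects; closes no item; no definition, no named fact, no `sorry`;
BSD is proved for no pair; no census number moves (T7).

## What this file proves

Sequel of `ErratumRoadFiveIMCDivMemberDivisible` (imc-p1 g9, the `𝒪`-coefficient `E`-side and the
unconditional member-side parts) and `ErratumRoadFiveIMCDivMemberCongruenceB2` (the congruence (b) over
`Γ_K` on the `K̄`-points). For a Hida member `D : Skinner2016.HidaCongruentMember W p m` (`m ≥ 1`,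
coefficient ring `𝒪_m = padicCoeffIntegers D.ι` FREE over `ℤ_p`) and a number field `K`:

* §1 **`forall_fixed_primary_eq_zero_cofreeRepOver`** — "no nonzero `(g i)`-fixed `p`-power torsion in
  `A_{g_m}`" from the GEOMETRIC statement "no nonzero `(g i)`-fixed `P ∈ E_K(K̄)` with `p P = O`": through
  (b) (`exists_torsionCongruence_baseChange`, g8's `BigRep.forall_fixed_primary_eq_zero_of_equiv_pow`) and
  the `𝒪`-side transfer (`forall_fixed_torsion_eq_zero_extendScalars_of_geomPoints`) — erratum (d)
  "`ρ̄_{f_m} ≅ ρ̄_f`"; hence **`hglob_cofreeRepOver`**, **`hloc_cofreeRepOver`** (geometric hypotheses +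
  "`Σ ∋` every `w ∣ N/p`").
* §2 **ALL ARITHMETIC INPUTS DISCHARGED from the erratum's binders** (`Irr(E[p])`, `K` imaginary quadratic,
  (iv) `E(ℚ_p)[p] = 0` with `K_𝔭 ↪ ℚ_p`, good reduction of `E_K` outside `Σ`, `Σ ∋` every `w ∣ N`,
  `p ∣ N`), by g8's `hglob_geomPoints_of_irr` ∕ `hdec_geomPoints_of_padicTorsion` ∕
  `hunr_primaryTorsionGaloisRep_of_hasGoodReductionAt` and the tree's `zsmul_geomPoints_surjective_holds`:
  `hdiv/hglob/hloc_extendScalars_erratum` (the `𝒪`-side `ρ𝒪 = (ρ_{E_K,p} ⊗ 1)`) and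
  `hglob/hloc_cofreeRepOver_erratum` (the member; its `hdiv` is the unconditional `hdiv_cofreeRepOver`) — the six divisibility hypotheses of
  `RoadFFMember.nonempty_memberCongruence` at the erratum data, modulo `Module.Free ℤ_[p] 𝒪_m`.

References: [Castella2018Erratum] Thm. 1.1 (iii)(iv), Lemma 2.1 and its proof (p. 2), proof of Thm. 1.1
(b)(d) (p. 4); [Skinner2016PacificMC] §3.1 (b), (d) (p. 192); [EmertonPollackWeston2006] §3.1.
-/

set_option autoImplicit false

noncomputable section

open scoped TensorProduct Classical

open PowerSeries Field IsDedekindDomain NumberField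
open Literature.NumberTheory.GaloisRepresentations Literature.NumberTheory.EllipticCurves
  Literature.NumberTheory.EllipticCurves.BigRepModule Literature.NumberTheory.EllipticCurves.BigGaloisRep
  Literature.NumberTheory.EllipticCurves.GreenbergSelmer Literature.NumberTheory.EllipticCurves.Skinner2016
  WeierstrassCurve

namespace Summit.BirchSwinnertonDyer.Rank1Residual.X11b.RoadFFMember

variable {W : WeierstrassCurve ℚ} [W.IsGloballyMinimal] {p : ℕ} [Fact p.Prime] {m : ℕ}
  (D : HidaCongruentMember W p m) (K : Type) [Field K] [NumberField K]
  [Module.Free ℤ_[p] (padicCoeffIntegers D.ι)]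

/-! ### §1 The member's fixed-torsion inputs through (b) -/

/-- **No nonzero fixed `p`-power torsion in `A_{g_m}|_{Γ_K}`** (for a family `(g i)` in `Γ_K`) from "no
nonzero `(g i)`-fixed geometric point `P ∈ E_K(K̄)` with `p P = O`": a fixed `p`-torsion element of `A_{g_m}`
is fixed `p^m`-torsion (`m ≥ 1`), goes through the `𝒪_m[Γ_K]`-isomorphism (b)
`A_{g_m}[p^m] ≃ (𝒪_m ⊗ E_K(K̄)[p^∞])[p^m]` to a fixed `p^m`-torsion element of `𝒪_m ⊗ E_K[p^∞]`, which
vanishes (`𝒪_m` free over `ℤ_p`: componentwise in `E_K[p^∞]`). Erratum (d): "`ρ̄_{f_m} ≅ ρ̄_f`".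
[cite: Castella2018Erratum, proof of Thm. 1.1, (b)(d) and Lemma 2.1 (pp. 2, 4)] [cite: Skinner2016PacificMC, §3.1 (b), (d) (p. 192)] -/
theorem forall_fixed_primary_eq_zero_cofreeRepOver (hm : 1 ≤ m) {ι' : Type*}
    (g : ι' → absoluteGaloisGroup K)
    (h0 : ∀ P : (W.baseChange K).geomPoints, (∀ i, g i • P = P) → p • P = 0 → P = 0) :
    ∀ a : Cofree D.Δ.ρ (padicCoeffField D.ι), (∀ i, D.Δ.cofreeRepOver K (g i) a = a) →
      (∃ k : ℕ, p ^ k • a = 0) → a = 0 := by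
  refine (exists_torsionCongruence_baseChange D K).elim fun e he => ?_
  exact BigRep.forall_fixed_primary_eq_zero_of_equiv_pow (D.Δ.cofreeRepOver K)
    (ContinuousRep.extendScalars (R := ℤ_[p]) (G := absoluteGaloisGroup K)
      (A := PrimaryTorsion (W.baseChange K).geomPoints p) (padicCoeffIntegers D.ι)
      ((W.baseChange K).primaryTorsionGaloisRep p)) hm e he g
    (forall_fixed_torsion_eq_zero_extendScalars_of_geomPoints (padicCoeffIntegers D.ι) (W.baseChange K) g h0)

variable [TopologicalSpace (PowerSeries (padicCoeffIntegers D.ι))]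
  [ContinuousSMul (PowerSeries (padicCoeffIntegers D.ι))
    (BigRepModule (padicCoeffIntegers D.ι) p (Cofree D.Δ.ρ (padicCoeffField D.ι)))]

/-- **`hglob` for `M_{g_m} = AnticyclotomicBigGaloisRep κ (A_{g_m}|_{Γ_K})`** from "no nonzero `Γ_K`-fixed
geometric `p`-torsion of `E_K`" (`E(K)[p] = 0`), through (b). [cite: Castella2018Erratum, Lemma 2.1, proof (p. 2: "H⁰(K, M_g) = 0 … irreducibility of ρ̄_g|_{G_K}")] -/
theorem hglob_cofreeRepOver (hm : 1 ≤ m) (κ : ZpExtension K p)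
    (hK : ∀ P : (W.baseChange K).geomPoints, (∀ σ : absoluteGaloisGroup K, σ • P = P) → p • P = 0 → P = 0) :
    ∀ m' : ℕ, 1 ≤ m' → ∀ x ∈ (AnticyclotomicBigGaloisRep κ (D.Δ.cofreeRepOver K)).toTopRep.ρ.invariants,
      ∃ x' ∈ (AnticyclotomicBigGaloisRep κ (D.Δ.cofreeRepOver K)).toTopRep.ρ.invariants,
        (C (p : padicCoeffIntegers D.ι) : PowerSeries (padicCoeffIntegers D.ι)) ^ m' • x' = x :=
  BigRep.divisibleInvariants_anticyclotomicBigGaloisRep κ _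
    (forall_fixed_primary_eq_zero_cofreeRepOver D K hm (fun σ : absoluteGaloisGroup K => σ) hK)

/-- **`hloc` for `M_{g_m}`** at `(localMap K, strictSet p 𝔮 Σ)` from "no nonzero `Γ_{K_𝔮}`-fixed geometric
`p`-torsion of `E_K`" (through (b)), "`Σ` contains every place dividing the level `N/p` of `g_m`"
(unramifiedness of `A_{g_m}` outside `Σ ∪ S_p`, `hunr_cofreeRepOver`) and `p`-divisibility of `A_{g_m}`.
[cite: Castella2018Erratum, Lemma 2.1 and its proof (p. 2)] -/
theorem hloc_cofreeRepOver (hm : 1 ≤ m) (κ : ZpExtension K p) (𝔮 : HeightOneSpectrum (𝓞 K))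
    (S : Set (HeightOneSpectrum (𝓞 K)))
    (h𝔮 : ∀ P : (W.baseChange K).geomPoints, (∀ σ : absoluteGaloisGroup (𝔮.adicCompletion K),
        absGaloisRestrict K (𝔮.adicCompletion K) σ • P = P) → p • P = 0 → P = 0)
    (hSM : ∀ w : HeightOneSpectrum (𝓞 K), w ∉ S → ((W.conductorNorm ℤ / p : ℕ) : 𝓞 K) ∉ w.asIdeal) :
    ∀ m' : ℕ, 1 ≤ m' → ∀ v ∈ strictSet p 𝔮 S,
      ∀ x ∈ (((AnticyclotomicBigGaloisRep κ (D.Δ.cofreeRepOver K)).restrict (localMap K v)).toTopRep).ρ.invariants,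
        ∃ x' ∈ (((AnticyclotomicBigGaloisRep κ (D.Δ.cofreeRepOver K)).restrict
            (localMap K v)).toTopRep).ρ.invariants,
          (C (p : padicCoeffIntegers D.ι) : PowerSeries (padicCoeffIntegers D.ι)) ^ m' • x' = x :=
  BigRep.divisibleInvariants_localMap_strictSet κ _ 𝔮 S
    (fun a _ => cofree_divisible (padicCoeffField D.ι) D.Δ.ρ (Fact.out : p.Prime).ne_zero a)
    (forall_fixed_primary_eq_zero_cofreeRepOver D K hm
      (fun σ : absoluteGaloisGroup (𝔮.adicCompletion K) => absGaloisRestrict K (𝔮.adicCompletion K) σ) h𝔮)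
    (hunr_cofreeRepOver D.Δ K S hSM)

/-! ### §2 The arithmetic inputs discharged from the erratum's binders -/

omit [W.IsGloballyMinimal] [Fact p.Prime] [NumberField K] in
/-- "`Σ` contains every place dividing `N`" and `p ∣ N` give "`Σ` contains every place dividing `N/p`".
[cite: Castella2018Erratum, §2 (p. 2, "Σ … containing … the primes dividing N")] -/
theorem conductorNorm_div_notMem_of_conductorNorm_notMem (S : Set (HeightOneSpectrum (𝓞 K)))
    (hSN : ∀ w : HeightOneSpectrum (𝓞 K), w ∉ S → ((W.conductorNorm ℤ : ℕ) : 𝓞 K) ∉ w.asIdeal)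
    (hpN : p ∣ W.conductorNorm ℤ) :
    ∀ w : HeightOneSpectrum (𝓞 K), w ∉ S → ((W.conductorNorm ℤ / p : ℕ) : 𝓞 K) ∉ w.asIdeal := by
  intro w hw h
  refine hSN w hw ?_
  rw [← Nat.div_mul_cancel hpN, Nat.cast_mul]
  exact w.asIdeal.mul_mem_right _ h

section Erratum

variable [W.IsElliptic]

omit [W.IsGloballyMinimal] in
/-- `E_K(K̄)` is `p`-divisible (the tree's discharged `zsmul_geomPoints_surjective_holds`). [cite: SilvermanAEC2009, III.§4 (multiplication by `m` is surjective on `E(K̄)`)] -/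
theorem geomPoints_baseChange_divisible :
    ∀ P : (W.baseChange K).geomPoints, ∃ Q : (W.baseChange K).geomPoints, p • Q = P := fun P => by
  obtain ⟨Q, hQ⟩ := (W.baseChange K).zsmul_geomPoints_surjective_holds (n := (p : ℤ))
    (by exact_mod_cast (Fact.out : p.Prime).ne_zero) P
  exact ⟨Q, by rw [← natCast_zsmul]; exact hQ⟩

/-- **`hglob` for the member at the erratum data, inputs discharged**: `E[p]` irreducible, `K` imaginary
quadratic (g8's `hglob_geomPoints_of_irr`), through (b). [cite: Castella2018Erratum, Thm. 1.1 and Lemma 2.1, proof (p. 2)] -/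
theorem hglob_cofreeRepOver_erratum (hm : 1 ≤ m) (κ : ZpExtension K p) (hK : IsImaginaryQuadratic K)
    (hirr : W.HasIrreducibleModPGaloisRep p) :
    ∀ m' : ℕ, 1 ≤ m' → ∀ x ∈ (AnticyclotomicBigGaloisRep κ (D.Δ.cofreeRepOver K)).toTopRep.ρ.invariants,
      ∃ x' ∈ (AnticyclotomicBigGaloisRep κ (D.Δ.cofreeRepOver K)).toTopRep.ρ.invariants,
        (C (p : padicCoeffIntegers D.ι) : PowerSeries (padicCoeffIntegers D.ι)) ^ m' • x' = x :=
  hglob_cofreeRepOver D K hm κ (BigRep.hglob_geomPoints_of_irr W p hK hirr)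

omit [W.IsElliptic] in
/-- **`hloc` for the member at the erratum data, inputs discharged**: (iv) `E(ℚ_p)[p] = 0` with
`K_𝔭 ↪ ℚ_p` (g8's `hdec_geomPoints_of_padicTorsion`), `Σ ∋` every `w ∣ N`, `p ∣ N`, through (b).
[cite: Castella2018Erratum, Thm. 1.1 (iv), Lemma 2.1 and its proof (pp. 1–2)] -/
theorem hloc_cofreeRepOver_erratum (hm : 1 ≤ m) (κ : ZpExtension K p) (𝔭 : HeightOneSpectrum (𝓞 K))
    (φ : 𝔭.adicCompletion K →+* ℚ_[p]) (S : Set (HeightOneSpectrum (𝓞 K)))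
    (hiv : ∀ Q : (W.baseChange ℚ_[p]).toAffine.Point, p • Q = 0 → Q = 0)
    (hSN : ∀ w : HeightOneSpectrum (𝓞 K), w ∉ S → ((W.conductorNorm ℤ : ℕ) : 𝓞 K) ∉ w.asIdeal)
    (hpN : p ∣ W.conductorNorm ℤ) :
    ∀ m' : ℕ, 1 ≤ m' → ∀ v ∈ strictSet p 𝔭 S,
      ∀ x ∈ (((AnticyclotomicBigGaloisRep κ (D.Δ.cofreeRepOver K)).restrict (localMap K v)).toTopRep).ρ.invariants,
        ∃ x' ∈ (((AnticyclotomicBigGaloisRep κ (D.Δ.cofreeRepOver K)).restrict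
            (localMap K v)).toTopRep).ρ.invariants,
          (C (p : padicCoeffIntegers D.ι) : PowerSeries (padicCoeffIntegers D.ι)) ^ m' • x' = x :=
  hloc_cofreeRepOver D K hm κ 𝔭 S (BigRep.hdec_geomPoints_of_padicTorsion W p K 𝔭 φ hiv)
    (conductorNorm_div_notMem_of_conductorNorm_notMem K S hSN hpN)

omit [TopologicalSpace (PowerSeries (padicCoeffIntegers D.ι))]
  [ContinuousSMul (PowerSeries (padicCoeffIntegers D.ι))
    (BigRepModule (padicCoeffIntegers D.ι) p (Cofree D.Δ.ρ (padicCoeffField D.ι)))]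

variable (𝒪 : Type) [CommRing 𝒪] [Algebra ℤ_[p] 𝒪] [TopologicalSpace 𝒪] [Module.Free ℤ_[p] 𝒪]
  [TopologicalSpace (PowerSeries 𝒪)]
  [ContinuousSMul (PowerSeries 𝒪)
    (BigRepModule 𝒪 p (CoeffExtension ℤ_[p] 𝒪 (PrimaryTorsion (W.baseChange K).geomPoints p)))]

omit [W.IsGloballyMinimal] [Module.Free ℤ_[p] (padicCoeffIntegers D.ι)] [Module.Free ℤ_[p] 𝒪]
  [TopologicalSpace 𝒪] [TopologicalSpace (PowerSeries 𝒪)]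
  [ContinuousSMul (PowerSeries 𝒪)
    (BigRepModule 𝒪 p (CoeffExtension ℤ_[p] 𝒪 (PrimaryTorsion (W.baseChange K).geomPoints p)))] in
/-- **`hdiv` for `𝒪 ⊗ E_K[p^∞]` at the erratum data** (unconditional: `E(K̄)` is divisible).
[cite: Skinner2016PacificMC, §2.3, proof of Lemma 2.3.1 (p. 180)] -/
theorem hdiv_extendScalars_erratum :
    Function.Surjective fun Φ : BigRepModule 𝒪 p
        (CoeffExtension ℤ_[p] 𝒪 (PrimaryTorsion (W.baseChange K).geomPoints p)) =>
      (C (p : 𝒪) : PowerSeries 𝒪) • Φ :=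
  hdiv_extendScalars 𝒪 (W.baseChange K) (geomPoints_baseChange_divisible K (W := W))

omit [W.IsGloballyMinimal] [Module.Free ℤ_[p] (padicCoeffIntegers D.ι)] in
/-- **`hglob` for `𝒪 ⊗ E_K[p^∞]` at the erratum data, inputs discharged** (`E[p]` irreducible, `K`
imaginary quadratic; `𝒪` free over `ℤ_p`). [cite: Castella2018Erratum, Lemma 2.1, proof (p. 2)] -/
theorem hglob_extendScalars_erratum (κ : ZpExtension K p) (hK : IsImaginaryQuadratic K)
    (hirr : W.HasIrreducibleModPGaloisRep p) :
    ∀ m' : ℕ, 1 ≤ m' →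
      ∀ x ∈ (AnticyclotomicBigGaloisRep κ (ContinuousRep.extendScalars (R := ℤ_[p])
          (G := absoluteGaloisGroup K) (A := PrimaryTorsion (W.baseChange K).geomPoints p) 𝒪
          ((W.baseChange K).primaryTorsionGaloisRep p))).toTopRep.ρ.invariants,
        ∃ x' ∈ (AnticyclotomicBigGaloisRep κ (ContinuousRep.extendScalars (R := ℤ_[p])
          (G := absoluteGaloisGroup K) (A := PrimaryTorsion (W.baseChange K).geomPoints p) 𝒪
          ((W.baseChange K).primaryTorsionGaloisRep p))).toTopRep.ρ.invariants,
          (C (p : 𝒪) : PowerSeries 𝒪) ^ m' • x' = x :=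
  hglob_extendScalars 𝒪 (W.baseChange K) κ (BigRep.hglob_geomPoints_of_irr W p hK hirr)

omit [W.IsGloballyMinimal] [Module.Free ℤ_[p] (padicCoeffIntegers D.ι)] in
/-- **`hloc` for `𝒪 ⊗ E_K[p^∞]` at the erratum data, inputs discharged**: (iv) with `K_𝔭 ↪ ℚ_p`, good
reduction of `E_K` outside `Σ` (Néron–Ogg–Shafarevich, g8's `hunr_primaryTorsionGaloisRep_of_hasGoodReductionAt`),
divisibility of `E(K̄)`; `𝒪` free over `ℤ_p`. [cite: Castella2018Erratum, Thm. 1.1 (iv), Lemma 2.1 and its proof (pp. 1–2)] -/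
theorem hloc_extendScalars_erratum (κ : ZpExtension K p) (𝔭 : HeightOneSpectrum (𝓞 K))
    (φ : 𝔭.adicCompletion K →+* ℚ_[p]) (S : Set (HeightOneSpectrum (𝓞 K)))
    (hiv : ∀ Q : (W.baseChange ℚ_[p]).toAffine.Point, p • Q = 0 → Q = 0)
    (hS : ∀ w : HeightOneSpectrum (𝓞 K), w ∉ S → (W.baseChange K).HasGoodReductionAt w) :
    ∀ m' : ℕ, 1 ≤ m' → ∀ v ∈ strictSet p 𝔭 S,
      ∀ x ∈ (((AnticyclotomicBigGaloisRep κ (ContinuousRep.extendScalars (R := ℤ_[p])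
          (G := absoluteGaloisGroup K) (A := PrimaryTorsion (W.baseChange K).geomPoints p) 𝒪
          ((W.baseChange K).primaryTorsionGaloisRep p))).restrict (localMap K v)).toTopRep).ρ.invariants,
        ∃ x' ∈ (((AnticyclotomicBigGaloisRep κ (ContinuousRep.extendScalars (R := ℤ_[p])
          (G := absoluteGaloisGroup K) (A := PrimaryTorsion (W.baseChange K).geomPoints p) 𝒪
          ((W.baseChange K).primaryTorsionGaloisRep p))).restrict (localMap K v)).toTopRep).ρ.invariants,
          (C (p : 𝒪) : PowerSeries 𝒪) ^ m' • x' = x :=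
  hloc_extendScalars 𝒪 (W.baseChange K) κ 𝔭 S (geomPoints_baseChange_divisible K (W := W))
    (BigRep.hdec_geomPoints_of_padicTorsion W p K 𝔭 φ hiv)
    (BigRep.hunr_primaryTorsionGaloisRep_of_hasGoodReductionAt (W.baseChange K) p S hS)

end Erratum

end Summit.BirchSwinnertonDyer.Rank1Residual.X11b.RoadFFMember

end
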